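import Summits.QuantumFields.QCD.Theses.NestedDissectionSea
import Literature.Barriers.QuantumFields.WilsonDeterminantMassSplitting

/-!
# Sketch — crux-ideate `SeaFactorisationBridge` (stmt-QuantumFields-13880), round 1, ideator 3

First lemmas of the three crux idea cards (they only have to elaborate; the cheap ones are proved):

* Card A `degenerate-doublet-anchor`: `splitDoublet_det_mul_eq` (proved), `splitDoublet_det_pos`
  (proved), `PairingDefectForcesWindowCrossing`, `ResonantCellSingularSeparator` (statements).
* Card B `condition-then-quench`: `pushforward_block_observable` (proved, `integral_map`),
  `condQuench_lower` (proved), `SignedBlockSeaDominates` (statement).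
* Card C `average-the-dissection`: `average_of_shifted_decompositions` (proved),
  `UVSeparatorActivityBound` (statement).
-/

namespace Summit.QuantumFields.QCD.Cruxes.SeaFactorisationBridge.Ideator3

open Matrix Complex Filter Topology MeasureTheory
open scoped BigOperators ComplexOrder
open Literature.MathematicalPhysics.QuantumLattice Literature.MathematicalPhysics.QuantumFieldTheory
open Literature.Probability.LatticeModels
open Literature.Barriers.QuantumFields.WilsonSign

/-- Local notation: the colour group `SU(3)`. -/
local notation "SU3" => Matrix.specialUnitaryGroup (Fin 3) ℂ

/-! ## Card A — degenerate-doublet anchor -/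

section CardA

variable {n : Type*} [Fintype n] [DecidableEq n]

/-- **A1 (proved).** The split two-flavour weight is the determinant of `(D + m̄)² − δ²`:
`det(D + m̄ + δ) · det(D + m̄ − δ) = det((D + m̄)² − δ²·1)` — the mass splitting enters only
through `δ²`. -/
theorem splitDoublet_det_mul_eq (D : Matrix n n ℂ) (m δ : ℝ) :
    (D + ((m + δ : ℝ) : ℂ) • (1 : Matrix n n ℂ)).det * (D + ((m - δ : ℝ) : ℂ) • (1 : Matrix n n ℂ)).det =
      ((D + ((m : ℝ) : ℂ) • (1 : Matrix n n ℂ)) ^ 2 - ((δ : ℂ) ^ 2) • (1 : Matrix n n ℂ)).det := by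
  set A : Matrix n n ℂ := D + ((m : ℝ) : ℂ) • 1 with hA
  set S : Matrix n n ℂ := (δ : ℂ) • 1 with hS
  have h1 : D + ((m + δ : ℝ) : ℂ) • (1 : Matrix n n ℂ) = A + S := by
    rw [hA, hS, Complex.ofReal_add, add_smul, add_assoc]
  have h2 : D + ((m - δ : ℝ) : ℂ) • (1 : Matrix n n ℂ) = A - S := by
    rw [hA, hS, Complex.ofReal_sub, sub_smul]
    abel
  have hc : Commute A S := (Commute.one_right A).smul_right (δ : ℂ)
  have hSS : S * S = ((δ : ℂ) ^ 2) • (1 : Matrix n n ℂ) := by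
    rw [hS, smul_mul_smul_comm, one_mul, sq]
  rw [h1, h2, ← det_mul, ← hc.mul_self_sub_mul_self_eq, show A ^ 2 = A * A from sq A, hSS]

/-- **A2 (proved).** If `D` is `Γ`-Hermitian and has NO real-mode crossing in the closed window
`[m̄ − δ, m̄ + δ]` (no `t` with `|t| ≤ δ` and `det(D + m̄ + t) = 0`), then the split two-flavour weight
`det(D + m̄ + δ) det(D + m̄ − δ)` is real and STRICTLY POSITIVE. (Connectedness: along
`t ∈ [0, δ]` the product is real, non-vanishing, and a positive square at `t = 0`.) This is the
quantitative converse of the barrier theorem `exists_zero_between_of_det_mul_neg`. -/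
theorem splitDoublet_det_pos {Γ D : Matrix n n ℂ} (hD : IsGammaHermitian Γ D) (m δ : ℝ) (hδ : 0 ≤ δ)
    (hres : ∀ t : ℝ, |t| ≤ δ → (D + ((m + t : ℝ) : ℂ) • (1 : Matrix n n ℂ)).det ≠ 0) :
    0 < ((D + ((m + δ : ℝ) : ℂ) • (1 : Matrix n n ℂ)).det *
          (D + ((m - δ : ℝ) : ℂ) • (1 : Matrix n n ℂ)).det).re := by
  let g : ℝ → ℂ := fun t =>
    (D + ((m + t : ℝ) : ℂ) • (1 : Matrix n n ℂ)).det * (D + ((m - t : ℝ) : ℂ) • (1 : Matrix n n ℂ)).det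
  change 0 < (g δ).re
  have him : ∀ t : ℝ, (g t).im = 0 := by
    intro t
    have h1 := (hD.add_real (m + t)).det_im
    have h2 := (hD.add_real (m - t)).det_im
    change ((D + ((m + t : ℝ) : ℂ) • (1 : Matrix n n ℂ)).det *
      (D + ((m - t : ℝ) : ℂ) • (1 : Matrix n n ℂ)).det).im = 0
    rw [Complex.mul_im, h1, h2, mul_zero, zero_mul, add_zero]
  have hcont : Continuous fun t => (g t).re := by
    refine Complex.continuous_re.comp (Continuous.mul ?_ ?_)
    · exact Continuous.matrix_det
        (continuous_const.add ((Complex.continuous_ofReal.comp (continuous_const.add continuous_id)).smul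
          continuous_const))
    · exact Continuous.matrix_det
        (continuous_const.add ((Complex.continuous_ofReal.comp (continuous_const.sub continuous_id)).smul
          continuous_const))
  have hne : ∀ t ∈ Set.Icc 0 δ, (g t).re ≠ 0 := by
    intro t ht hzero
    have hgz : g t = 0 := Complex.ext (by simpa using hzero) (by simpa using him t)
    have hgz' : (D + ((m + t : ℝ) : ℂ) • (1 : Matrix n n ℂ)).det *
        (D + ((m - t : ℝ) : ℂ) • (1 : Matrix n n ℂ)).det = 0 := hgz
    rcases mul_eq_zero.1 hgz' with h | h
    · exact hres t (by rw [abs_of_nonneg ht.1]; exact ht.2) h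
    · have habs : |(-t)| ≤ δ := by rw [abs_neg, abs_of_nonneg ht.1]; exact ht.2
      have h' := hres (-t) habs
      apply h'
      have hmt : m + -t = m - t := by ring
      rw [hmt]
      exact h
  have h0 : 0 < (g 0).re := by
    have hreal : ((D + ((m : ℝ) : ℂ) • (1 : Matrix n n ℂ)).det).im = 0 := (hD.add_real m).det_im
    have hne0 : (D + ((m : ℝ) : ℂ) • (1 : Matrix n n ℂ)).det ≠ 0 := by
      have h := hres 0 (by rw [abs_zero]; exact hδ)
      rw [add_zero] at h
      exact h
    have hre : ((D + ((m : ℝ) : ℂ) • (1 : Matrix n n ℂ)).det).re ≠ 0 := by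
      intro h
      exact hne0 (Complex.ext (by simpa using h) (by simpa using hreal))
    change 0 < ((D + ((m + 0 : ℝ) : ℂ) • (1 : Matrix n n ℂ)).det *
      (D + ((m - 0 : ℝ) : ℂ) • (1 : Matrix n n ℂ)).det).re
    rw [add_zero, sub_zero, Complex.mul_re, hreal, mul_zero, sub_zero]
    exact mul_self_pos.2 hre
  by_contra hle
  push Not at hle
  have hmem : (0 : ℝ) ∈ Set.Icc ((fun t => (g t).re) δ) ((fun t => (g t).re) 0) := ⟨hle, h0.le⟩
  obtain ⟨s, hs, hs0⟩ := intermediate_value_Icc' hδ hcont.continuousOn hmem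
  exact hne s hs hs0

/-- **A3 (statement; provable now from A2 / the barrier's `exists_zero_between_of_det_mul_neg`
restricted to Dirichlet cells, which stay `γ₅`-Hermitian because `Γ₅` is site-diagonal, and from
the cell form of `wilsonDirac_add_mass`).** A PAIRING DEFECT of a Dirichlet cell — a negative
split two-flavour cell weight at bare masses `μ ± δ` — forces a real-mode crossing of that cell
STRICTLY INSIDE the lattice-mass window `(μ − δ, μ + δ)`, whose width `2δ = a_k Δm / Z_m(k) → 0`. -/
def PairingDefectForcesWindowCrossing : Prop :=
  ∀ (N : ℕ) [NeZero N] (U : GaugeConfig 4 N SU3) (μ δ : ℝ), 0 < δ →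
    ∀ (x : TorusSite 4 N) (s : Fin 4 → ℕ),
      ((wilsonCell U (μ + δ) x s).det * (wilsonCell U (μ - δ) x s).det).re < 0 →
        ∃ t ∈ Set.Ioo (μ - δ) (μ + δ), (wilsonCell U t x s).det = 0

/-- **A4 (statement; deterministic linear algebra, size M).** One level of the transfer
"δ-resonant cell ⇒ singular separator": if the sixteen children of the corner-`0` box are
`κ`-coercive and the box has a vector with residual below `w < κ`, then its internal separator is
singular in the harmonic-extension form of `HasSingularSeparator` at level
`w (1 + 8/κ)² / (1 − w/κ)` (`8` bounds the norm of the Wilson hopping blocks `D_ΣI`, `D_IΣ`; the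
harmonic correction is `x ↦ x − D_II⁻¹ r_I`). It is where CoerciveSea (i) meets card A: with
`w = δ ∝ a_k` and Dirichlet-coercive children `κ ≍ c/s` the separator level is `≍ δ s²`, i.e.
`t ≍ δ s³` in clause (i)'s normalisation — a RATE `a_k^α` for cells of lattice side `≲ a_k^{-1/4}`. -/
def ResonantCellSingularSeparator : Prop :=
  ∀ (N : ℕ) [NeZero N] (U : GaugeConfig 4 N SU3) (μ w κ : ℝ), 0 < w → w < κ →
    ∀ s : Fin 4 → ℕ, (∀ i, s i ≤ N) →
      (∀ (ε : Fin 4 → Bool) (u : {p // wilsonBox (halfCorner s ε : TorusSite 4 N) (halfSides s ε) p} → ℂ),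
        κ ^ 2 * ∑ p, ‖u p‖ ^ 2 ≤
          ∑ p, ‖(wilsonCell U μ (halfCorner s ε) (halfSides s ε)).mulVec u p‖ ^ 2) →
      (∃ v : {p // wilsonBox (0 : TorusSite 4 N) s p} → ℂ, v ≠ 0 ∧
        ∑ p, ‖(wilsonCell U μ 0 s).mulVec v p‖ ^ 2 < w ^ 2 * ∑ p, ‖v p‖ ^ 2) →
      HasSingularSeparator U μ s (w * (1 + 8 / κ) ^ 2 / (1 - w / κ))

end CardA

/-! ## Card B — condition on the block field, then quench -/

section CardB

/-- **B1 (proved; `integral_map`).** The IR input only ever sees the block functional: for every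
block map `B`, block observable `F` and block-level weight, fine-lattice expectations of
`F ∘ B` are expectations under the pushforward `B_* μ`. -/
theorem pushforward_block_observable {Ω V : Type*} [MeasurableSpace Ω] [MeasurableSpace V]
    (μ : Measure Ω) (B : Ω → V) (hB : AEMeasurable B μ) (F : V → ℝ)
    (hF : AEStronglyMeasurable F (μ.map B)) :
    ∫ x, F (B x) ∂μ = ∫ v, F v ∂(μ.map B) :=
  (integral_map hB hF).symm

/-- **B2 (proved).** Conditional quenching: on every block event `E = B⁻¹(A)`, if the bad (sign
`−1`) part of the positive weight `w` has relative mass `≤ p`, the SIGNED weight `σ w` integrates to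
at least `(1 − 2p)` times the quenched weight — `|E[· | V]|` dominates `(1 − 2p) E[|·| | V]`
block-event-wise, so the signed block-scale sea `−log E[signed sea | V]` exists and is within
`log(1/(1−2p))` of the quenched one wherever defects are CONDITIONALLY rare. (`b` is the bad part,
`σ w = w − 2b` pointwise.) -/
theorem condQuench_lower {Ω : Type*} [MeasurableSpace Ω] (μ : Measure Ω) (E : Set Ω)
    (w b σ : Ω → ℝ) (hσw : ∀ x, σ x * w x = w x - 2 * b x)
    (hwi : IntegrableOn w E μ) (hbi : IntegrableOn b E μ) (p : ℝ)
    (hrare : ∫ x in E, b x ∂μ ≤ p * ∫ x in E, w x ∂μ) :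
    (1 - 2 * p) * ∫ x in E, w x ∂μ ≤ ∫ x in E, σ x * w x ∂μ := by
  have h : ∫ x in E, σ x * w x ∂μ = (∫ x in E, w x ∂μ) - 2 * ∫ x in E, b x ∂μ := by
    simp_rw [hσw]
    rw [integral_sub hwi (hbi.const_mul 2), integral_const_mul]
  rw [h]
  have hring : (1 - 2 * p) * ∫ x in E, w x ∂μ = (∫ x in E, w x ∂μ) - 2 * (p * ∫ x in E, w x ∂μ) := by
    ring
  linarith [hrare, hring]

/-- **B3 (statement of the line's hand-over object, informal rate made a hypothesis).** For a
block map `B` on the fine SU(3) configurations of the odd torus, a positive weight `w` (the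
degenerate / phase-quenched sea times the Wilson weight) and the cell-sign field `σ`, IF the
`w`-weighted conditional defect probability is `≤ p < 1/2` on every block event inside a block set
`G` ("good block data"), THEN the signed pushforward `B_*(σ w μ)` and the quenched pushforward
`B_*(w μ)` are mutually bounded by the factors `1 − 2p` and `1` on `G`. This is B2 read at the level
of measures; `G` = Bałaban small-field block data is the bet of the card. -/
def SignedBlockSeaDominates : Prop :=
  ∀ (Ω V : Type) [MeasurableSpace Ω] [MeasurableSpace V] (μ : Measure Ω) (B : Ω → V), Measurable B →
    ∀ (w b σ : Ω → ℝ), (∀ x, 0 ≤ b x ∧ b x ≤ w x) → (∀ x, σ x * w x = w x - 2 * b x) →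
      Integrable w μ → Integrable b μ →
      ∀ (p : ℝ) (G : Set V), MeasurableSet G →
        (∀ A ⊆ G, MeasurableSet A → ∫ x in B ⁻¹' A, b x ∂μ ≤ p * ∫ x in B ⁻¹' A, w x ∂μ) →
        ∀ A ⊆ G, MeasurableSet A →
          (1 - 2 * p) * ∫ x in B ⁻¹' A, w x ∂μ ≤ ∫ x in B ⁻¹' A, σ x * w x ∂μ ∧
            ∫ x in B ⁻¹' A, σ x * w x ∂μ ≤ ∫ x in B ⁻¹' A, w x ∂μ

end CardB

/-! ## Card C — average the dissection -/

section CardC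

/-- **C1 (proved).** The translation average of the shifted exact decompositions is an exact
decomposition: if `F` is invariant under a finite group of shifts and `F = ∑_c φ_c` identically,
then `F(x) = |G|⁻¹ ∑_g ∑_c φ_c(g·x)`. Applied to `F = log |det D_W|`, the shifts = torus
translations and `φ_c = log |det S_Σ(c)|` (nested-dissection separator activities), it exhibits the
sea as a TRANSLATION-INVARIANT sum over levels `j` of local activities with weight `1/|c_j|` per
position — still a product of local factors after exponentiation. -/
theorem average_of_shifted_decompositions {G X : Type*} [Fintype G] [Nonempty G] (act : G → X → X)
    (F : X → ℝ) (hF : ∀ g x, F (act g x) = F x) {ι : Type*} [Fintype ι] (φ : ι → X → ℝ)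
    (hdec : ∀ x, F x = ∑ c, φ c x) (x : X) :
    F x = (Fintype.card G : ℝ)⁻¹ * ∑ g : G, ∑ c, φ c (act g x) := by
  have h : ∀ g : G, ∑ c, φ c (act g x) = F x := fun g => by rw [← hdec, hF]
  simp_rw [h]
  rw [Finset.sum_const, Finset.card_univ, nsmul_eq_mul, ← mul_assoc, inv_mul_cancel₀, one_mul]
  exact Nat.cast_ne_zero.2 Fintype.card_ne_zero

/-- **C2 (statement; deterministic, provable now from `KineticEdge` (b) = numerical range +
diamagnetic inequality, and Hadamard).** UV SEPARATOR ACTIVITIES ARE BOUNDED: below the kinetic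
edge (the free Dirichlet floor of the box exceeds `τ − μ`, that of the children exceeds `τ' − μ`)
the children block is invertible, the separator factor obeys
`τ^{|Σ|} ≤ |det S_Σ| ≤ (8 + |μ| + 64/τ')^{|Σ|}`, hence `|log |det S_Σ|| ≤ C |Σ|`: at every UV level
`j` (cells of side `< s_free ≍ 2.75 β^{1/2}`) the translation-averaged level-`j` action density of the
sea is `O(|Σ_j| / |c_j|) = O(1/s_j)` uniformly in the gauge field, so sheet counterterms are
HOMOGENEOUS and summable over `j`. -/
def UVSeparatorActivityBound : Prop :=
  ∀ (N : ℕ) [NeZero N] (U : GaugeConfig 4 N SU3) (μ τ τ' : ℝ), 0 < τ → 0 < τ' →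
    ∀ s : Fin 4 → ℕ, (∀ i, 2 ≤ s i ∧ s i ≤ N) →
      τ - μ ≤ ∑ i, (1 - Real.cos (Real.pi / s i)) →
      τ' - μ ≤ ∑ i, (1 - Real.cos (Real.pi / (s i / 2 : ℕ))) →
      IsUnit (childrenBlock U μ s).det ∧
        τ ^ Fintype.card {p : {p // wilsonBox (0 : TorusSite 4 N) s p} // ¬ childrenInterior s p} ≤
            ‖(schurSeparator U μ s).det‖ ∧
          ‖(schurSeparator U μ s).det‖ ≤
            (8 + |μ| + 64 / τ') ^ Fintype.card {p : {p // wilsonBox (0 : TorusSite 4 N) s p} // ¬ childrenInterior s p}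

end CardC

end Summit.QuantumFields.QCD.Cruxes.SeaFactorisationBridge.Ideator3
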